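import Summits.AtomisticToContinuum.Crystallization.Theorems.FrustratedLawDichotomyStrainedPatchHomEntryFrameHcpV
import Summits.AtomisticToContinuum.Crystallization.Theorems.FrustratedLawDichotomyStrainedPatchHomEntryTableP

/-!
# hcp VECTOR-FORM TABLE LEAF on entry/shuffle boxes, the tiered verdict v8, and ★★★ `(H)` with the P-twin on the hcp side

decomp-a2c hand-2 g25 (crux `AperiodicFrustratedLawGap`, stmt-AtomisticToContinuum-27623; (H) hcp side, critic rows 887/891/893 — the hcp count
bottleneck: the v5K class-box table needs entry half-width `2⁻¹⁵` near the critical centre `u6`; the vector-form leaf passes at `2⁻⁹`, pilot hand-2 g25).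

* §1 ★★ `leafCheckV_sound_hcp`: the label-sum form of `leafCheckV_sound_points` for the hcp frame (`hexFrame`, `hcpShift + ξ`) over the certified record
  list `nearLabelsH` (coverage / box / key certificates of hand-2 g24 reused): target `≤ Σ_{[−7,7]³∖0} W‖latPt U f b‖ + Σ_{[−7,7]³} W‖latPt U f b + U t‖`.
* §2 ★ `tableLeafOKHV tab E μ c w := shufInOK ∧ leafCheckV tab nearLabelsH E (lvOf c w) (2μ)` + ★★ `tableLeafOKHV_sound` (the `hver` shape, any
  semantically certified table); mirror driver `entryLeafOKHVT`.
* §3 ★ verdict v8 `entryLeafOKHVK μ := shufOut ∨ V-table(K1) ∨ V-table(K2) ∨ V-table(K3) ∨ V-table(K4) ∨ entryLeafOKH3RDTK μ` (the whole v5K verdict as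
  the fallback) + soundness, ★★ `hcpHalf_of_entrySearchHVK`, ★★★ `homFloor_of_entrySearches6RBKP_HVK` / `homFloor_625_of_entrySearches6RBKP_HVK`
  (fcc: hand-1's param-form `entryLeafOK6RBKP`; hcp: v8).

0 sorry; standard axioms.  `--supports stmt-AtomisticToContinuum-27623`.
-/

noncomputable section

namespace Summit.AtomisticToContinuum.Crystallization.Theorems.FrustratedLawDichotomyStrainedPatchHomLeafTableCheckHcpV

open scoped BigOperators RealInnerProductSpace
open Finset
open Literature.Analysis.ValidatedNumerics.Numerics
open Summit.AtomisticToContinuum.Crystallization.Theorems.ChargedEnergyGapNegative (E3)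
open Summit.AtomisticToContinuum.Crystallization.Theorems.FrustratedLawDichotomySchurCut (effPot w₄₅ ω₄)
open Summit.AtomisticToContinuum.Crystallization.Theorems.FrustratedLawDichotomyAveragingRuleTightFree (TightNearCap BadNearCap)
open Summit.AtomisticToContinuum.Crystallization.Theorems.FrustratedLawDichotomyExemptAbsorption (ExemptNear)
open Summit.AtomisticToContinuum.Crystallization.Theorems.FrustratedLawDichotomyStrainedPatchHomSplit
open Summit.AtomisticToContinuum.Crystallization.Theorems.FrustratedLawDichotomyStrainedPatchHomTermCalculus (effPot45_eq_far)
open Summit.AtomisticToContinuum.Crystallization.Theorems.FrustratedLawDichotomyStrainedPatchHomPrunedPolar (homFloor_of_prunedBoxSums_selfAdjoint)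
open Summit.AtomisticToContinuum.Crystallization.Theorems.FrustratedLawDichotomyStrainedPatchHomEntryGram (rootC rootW)
open Summit.AtomisticToContinuum.Crystallization.Theorems.FrustratedLawDichotomyStrainedPatchHomEntryGramHcp (rootCH rootWH)
open Summit.AtomisticToContinuum.Crystallization.Theorems.FrustratedLawDichotomyStrainedPatchHomEntryTable (muRec muRec_ok)
open Summit.AtomisticToContinuum.Crystallization.Theorems.FrustratedLawDichotomyStrainedPatchHomEntrySearch (searchOK)
open Summit.AtomisticToContinuum.Crystallization.Theorems.FrustratedLawDichotomyStrainedPatchHomEntrySymBox (symH hbox_symU)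
open Summit.AtomisticToContinuum.Crystallization.Theorems.FrustratedLawDichotomyStrainedPatchHomEntryFlipHcp
  (HcpDich shufOut false_of_shufOut hcpHalf_of_entrySearchShuf)
open Summit.AtomisticToContinuum.Crystallization.Theorems.FrustratedLawDichotomyStrainedPatchHomLeafTableCheck
  (QT sgnZ qTableK1 qTableK2 qTableK3 qTableK4 qTableK1_allOKK qTableK2_allOKK qTableK3_allOKK qTableK4_allOKK tabE)
open Summit.AtomisticToContinuum.Crystallization.Theorems.FrustratedLawDichotomyStrainedPatchHomLeafTableCheckHcp
  (NH famZ NH.toLab TabSem tabSem_of_allOKK nearLabelsH nearLabelsH_ok nearLabelsH_chain nearLabelsH_inBox nearLabelsH_cover ok_of_allOKH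
   keyNodup_of_chainLtH mem_of_allInBoxH cover_of_coverH effPot_sqrt_sq far_of_sq_ge)
open Summit.AtomisticToContinuum.Crystallization.Theorems.FrustratedLawDichotomyStrainedPatchHomEntryTableHcp
  (shufInOK abs_le_of_shufInOK sgnZ_two_natAbs entryLeafOKH3RDTK entryLeafOKH3RDTK_sound)
open Summit.AtomisticToContinuum.Crystallization.Theorems.FrustratedLawDichotomyStrainedPatchHomEntryTableP (entryLeafOK6RBKP fccHalf_of_entrySearch6RBKP)

/-! ## §1. ★★ The label-sum form over the certified record list -/

open Classical in
/-- ★★ **SOUNDNESS OF THE VECTOR-FORM LEAF, hcp label-sum form.** [folklore] -/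
theorem leafCheckV_sound_hcp {tab : QT} {E : ℕ} (htab : TabSem E tab) {k : LV} {sμ : Bool} {aμ : ℕ}
    (h : leafCheckV tab nearLabelsH E k sμ aμ = true)
    (U : E3 →L[ℝ] E3) (hU : ‖U - 1‖ ≤ 1 / 4) (ξ : E3) (hξ : ∀ i : Fin 3, |ξ i| ≤ 1 / 4)
    (hV : ∀ a c, |Vof U a c - ((k.vZ a c : ℤ) : ℝ) / SC| ≤ ((k.wN a c : ℕ) : ℝ) / SC) (hη : ∀ c, |etaof ξ c - ((k.nZ c : ℤ) : ℝ) / SC| ≤ ((k.mN c : ℕ) : ℝ) / SC) :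
    ((sgnZ sμ aμ : ℤ) : ℝ) / SC / 2 ≤
      ∑ b ∈ (Fintype.piFinset fun _ : Fin 3 => Finset.Icc (-7 : ℤ) 7).filter (fun b => b ≠ 0), effPot w₄₅ ω₄ (3 / 400) ‖latPt U hexFrame b‖ +
        ∑ b ∈ (Fintype.piFinset fun _ : Fin 3 => Finset.Icc (-7 : ℤ) 7), effPot w₄₅ ω₄ (3 / 400) ‖latPt U hexFrame b + U (hcpShift + ξ)‖ := by
  classical
  have hok : ∀ l ∈ nearLabelsH, l.ok = true := ok_of_allOKH nearLabelsH_ok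
  have hkey := keyNodup_of_chainLtH nearLabelsH_chain
  have hnd : nearLabelsH.Nodup := hkey.of_map _
  obtain ⟨hmemU, hmemS⟩ := mem_of_allInBoxH nearLabelsH_inBox
  obtain ⟨hcovU, hcovS⟩ := cover_of_coverH nearLabelsH_cover hU hξ
  obtain ⟨hpts, hfar⟩ := leafCheckV_sound_points htab hok hnd h (Vof U) (etaof ξ) hV hη
  set box := (Fintype.piFinset fun _ : Fin 3 => Finset.Icc (-7 : ℤ) 7).filter (fun b => b ≠ 0) with hboxdef
  set boxF := (Fintype.piFinset fun _ : Fin 3 => Finset.Icc (-7 : ℤ) 7) with hboxFdef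
  have hSdef : trS tab k nearLabelsH = (nearLabelsH.filter (fun l => treatedV tab k l)).toFinset := rfl
  set S := trS tab k nearLabelsH with hSS
  have hSmem : ∀ l ∈ S, l ∈ nearLabelsH ∧ treatedV tab k l = true := fun l hl => by
    have := List.mem_toFinset.1 (hSdef ▸ hl); exact ⟨List.mem_of_mem_filter this, (List.mem_filter.1 this).2⟩
  set Φ : NH → ℝ := fun l => effPot w₄₅ ω₄ (3 / 400) (Real.sqrt (qre l (Vof U) (etaof ξ))) with hΦ
  have hΦU : ∀ l ∈ nearLabelsH, l.fam = false → Φ l = effPot w₄₅ ω₄ (3 / 400) ‖latPt U hexFrame l.toLab‖ := fun l hl hf => by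
    simp only [hΦ]; rw [qre_vof_false (hok l hl) hf, effPot_sqrt_sq]
  have hΦS : ∀ l ∈ nearLabelsH, l.fam = true → Φ l = effPot w₄₅ ω₄ (3 / 400) ‖latPt U hexFrame l.toLab + U (hcpShift + ξ)‖ := fun l hl hf => by
    simp only [hΦ]; rw [qre_vof_true (hok l hl) hf, effPot_sqrt_sq]
  set S0 := S.filter (fun l => l.fam = false) with hS0
  set S1 := S.filter (fun l => ¬ l.fam = false) with hS1
  have hsplit : ∑ l ∈ S, Φ l = ∑ l ∈ S0, Φ l + ∑ l ∈ S1, Φ l := (Finset.sum_filter_add_sum_filter_not S _ Φ).symm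
  have hinj_key : Set.InjOn (fun l : NH => (l.fam, l.toLab)) {l | l ∈ nearLabelsH} := List.inj_on_of_nodup_map hkey
  have hinj0 : Set.InjOn NH.toLab ↑S0 := by
    intro l hl l' hl' hll
    have hl2 := Finset.mem_filter.1 (Finset.mem_coe.1 hl); have hl2' := Finset.mem_filter.1 (Finset.mem_coe.1 hl')
    exact hinj_key (hSmem l hl2.1).1 (hSmem l' hl2'.1).1 (by simp [hll, hl2.2, hl2'.2])
  have hinj1 : Set.InjOn NH.toLab ↑S1 := by
    intro l hl l' hl' hll
    have hl2 := Finset.mem_filter.1 (Finset.mem_coe.1 hl); have hl2' := Finset.mem_filter.1 (Finset.mem_coe.1 hl')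
    have e1 : l.fam = true := by simpa using hl2.2
    have e2 : l'.fam = true := by simpa using hl2'.2
    exact hinj_key (hSmem l hl2.1).1 (hSmem l' hl2'.1).1 (by simp [hll, e1, e2])
  have h0img : ∑ l ∈ S0, Φ l = ∑ b ∈ S0.image NH.toLab, effPot w₄₅ ω₄ (3 / 400) ‖latPt U hexFrame b‖ := by
    rw [Finset.sum_image hinj0]
    exact Finset.sum_congr rfl fun l hl => hΦU l (hSmem l (Finset.mem_filter.1 hl).1).1 (Finset.mem_filter.1 hl).2
  have h1img : ∑ l ∈ S1, Φ l = ∑ b ∈ S1.image NH.toLab, effPot w₄₅ ω₄ (3 / 400) ‖latPt U hexFrame b + U (hcpShift + ξ)‖ := by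
    rw [Finset.sum_image hinj1]
    exact Finset.sum_congr rfl fun l hl => hΦS l (hSmem l (Finset.mem_filter.1 hl).1).1 (by simpa using (Finset.mem_filter.1 hl).2)
  have h0box : ∑ b ∈ S0.image NH.toLab, effPot w₄₅ ω₄ (3 / 400) ‖latPt U hexFrame b‖ = ∑ b ∈ box, effPot w₄₅ ω₄ (3 / 400) ‖latPt U hexFrame b‖ := by
    apply Finset.sum_subset
    · intro b hb
      obtain ⟨l, hl, rfl⟩ := Finset.mem_image.1 hb
      have hl2 := Finset.mem_filter.1 hl
      exact hmemU l (hSmem l hl2.1).1 hl2.2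
    · intro b hb hnot
      refine effPot45_eq_far ?_
      rcases hcovU b hb with ⟨l, hl, hlf, rfl⟩ | hfarb
      · have hnt : treatedV tab k l = false := by
          by_contra ht
          have ht' : treatedV tab k l = true := by simpa using ht
          exact hnot (Finset.mem_image.2 ⟨l, Finset.mem_filter.2 ⟨hSdef ▸ List.mem_toFinset.2 (List.mem_filter.2 ⟨hl, ht'⟩), hlf⟩, rfl⟩)
        have := hfar l hl hnt
        rw [qre_vof_false (hok l hl) hlf] at this
        exact far_of_sq_ge this
      · exact hfarb
  have h1box : ∑ b ∈ S1.image NH.toLab, effPot w₄₅ ω₄ (3 / 400) ‖latPt U hexFrame b + U (hcpShift + ξ)‖ =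
      ∑ b ∈ boxF, effPot w₄₅ ω₄ (3 / 400) ‖latPt U hexFrame b + U (hcpShift + ξ)‖ := by
    apply Finset.sum_subset
    · intro b hb
      obtain ⟨l, hl, rfl⟩ := Finset.mem_image.1 hb
      have hl2 := Finset.mem_filter.1 hl
      exact hmemS l (hSmem l hl2.1).1 (by simpa using hl2.2)
    · intro b hb hnot
      refine effPot45_eq_far ?_
      rcases hcovS b hb with ⟨l, hl, hlf, rfl⟩ | hfarb
      · have hnt : treatedV tab k l = false := by
          by_contra ht
          have ht' : treatedV tab k l = true := by simpa using ht
          exact hnot (Finset.mem_image.2 ⟨l, Finset.mem_filter.2 ⟨hSdef ▸ List.mem_toFinset.2 (List.mem_filter.2 ⟨hl, ht'⟩), by simp [hlf]⟩, rfl⟩)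
        have := hfar l hl hnt
        rw [qre_vof_true (hok l hl) hlf] at this
        exact far_of_sq_ge this
      · exact hfarb
  calc ((sgnZ sμ aμ : ℤ) : ℝ) / SC / 2 ≤ ∑ l ∈ S, Φ l := hpts
    _ = _ := by rw [hsplit, h0img, h1img, h0box, h1box]

/-! ## §2. ★ The vector-form table verdict on an entry/shuffle box -/

/-- ★ **THE hcp VECTOR-FORM TABLE VERDICT on an entry/shuffle box, ANY table** `tab` at derivative half-width `E`: guard ∧ the vector-form leaf checker on
`lvOf c w` with the DOUBLED target `2μ`. -/
def tableLeafOKHV (tab : QT) (E : ℕ) (μ : ℤ) (c w : (Fin 3 × Fin 3) ⊕ Fin 3 → ℤ) : Bool :=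
  shufInOK c w && leafCheckV tab nearLabelsH E (lvOf c w) (decide (μ < 0)) (2 * μ.natAbs)

/-- ★★ **SOUNDNESS OF THE VECTOR-FORM TABLE VERDICT** in the `hver` shape (any semantically certified table). [folklore] -/
theorem tableLeafOKHV_sound {tab : QT} {E : ℕ} (htab : TabSem E tab) {μ : ℤ} {c w : (Fin 3 × Fin 3) ⊕ Fin 3 → ℤ}
    (h : tableLeafOKHV tab E μ c w = true) (U : E3 →L[ℝ] E3) (ξ : E3) (_hsa : ∀ v v' : E3, ⟪U v, v'⟫ = ⟪v, U v'⟫) (hU : ‖U - 1‖ ≤ 1 / 4)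
    (hbox : ∀ ab : Fin 3 × Fin 3, |(U (EuclideanSpace.single ab.2 (1 : ℝ))) ab.1 - (c (Sum.inl ab) : ℝ) / SC| ≤ (w (Sum.inl ab) : ℝ) / SC)
    (hξ : ∀ i : Fin 3, |ξ i - (c (Sum.inr i) : ℝ) / SC| ≤ (w (Sum.inr i) : ℝ) / SC) :
    (∀ (M : ℕ) (z : Fin M → E3) (c : Fin M), Function.Injective z →
        Set.range z = {x : E3 | dist x (z c) ≤ 133 / 10 ∧ ∃ a : Fin 3 → ℤ,
          x = z c + latPt U hexFrame a ∨ x = z c + latPt U hexFrame a + U (hcpShift + ξ)} →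
        TightNearCap (9 / 5) (3 / 2) z c ∨ ExemptNear (9 / 5) ExRec z c ∨ BadNearCap (9 / 5) (3 / 2) z c) ∨
      (μ : ℝ) / SC ≤ ∑ b ∈ (Fintype.piFinset fun _ : Fin 3 => Finset.Icc (-7 : ℤ) 7).filter (fun b => b ≠ 0), effPot w₄₅ ω₄ (3 / 400) ‖latPt U hexFrame b‖ +
        ∑ b ∈ (Fintype.piFinset fun _ : Fin 3 => Finset.Icc (-7 : ℤ) 7), effPot w₄₅ ω₄ (3 / 400) ‖latPt U hexFrame b + U (hcpShift + ξ)‖ := by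
  simp only [tableLeafOKHV, Bool.and_eq_true] at h
  obtain ⟨hin, hleaf⟩ := h
  refine Or.inr ?_
  obtain ⟨hV, hη⟩ := lvOf_mem U ξ hbox hξ
  have key := leafCheckV_sound_hcp htab hleaf U hU ξ (abs_le_of_shufInOK hin hξ) hV hη
  rw [sgnZ_two_natAbs] at key
  push_cast at key
  have e : 2 * (μ : ℝ) / SC / 2 = (μ : ℝ) / SC := by ring
  rw [e] at key
  exact key

/-- ★ The vector-form table verdict through the mirror `symH` (lower triangle read from the upper), any table. -/
def entryLeafOKHVT (tab : QT) (E : ℕ) (μ : ℤ) (c w : (Fin 3 × Fin 3) ⊕ Fin 3 → ℤ) : Bool := tableLeafOKHV tab E μ (symH c) (symH w)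

/-! ## §3. ★ Verdict v8 and ★★★ `(H)` -/

/-- ★ **hcp VERDICT v8**: shuffle-sign prune ∨ the VECTOR-FORM table on `qTableK1` ∨ `K2` ∨ `K3` ∨ `K4` (mirror; tight tier first) ∨ the whole v5K verdict
`entryLeafOKH3RDTK μ` (radial prune, class-box tables, fit prunes) as the fallback. -/
def entryLeafOKHVK (μ : ℤ) (c w : (Fin 3 × Fin 3) ⊕ Fin 3 → ℤ) : Bool :=
  shufOut c w || entryLeafOKHVT qTableK1 tabE μ c w || entryLeafOKHVT qTableK2 tabE μ c w || entryLeafOKHVT qTableK3 tabE μ c w ||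
    entryLeafOKHVT qTableK4 tabE μ c w || entryLeafOKH3RDTK μ c w

/-- ★ Soundness of `entryLeafOKHVK` relative to the fundamental domain. [folklore] -/
theorem entryLeafOKHVK_sound {μ : ℤ} {c w : (Fin 3 × Fin 3) ⊕ Fin 3 → ℤ} (h : entryLeafOKHVK μ c w = true) (U : E3 →L[ℝ] E3) (ξ : E3)
    (hsa : ∀ v v' : E3, ⟪U v, v'⟫ = ⟪v, U v'⟫) (hU : ‖U - 1‖ ≤ 1 / 4)
    (hbox : ∀ ab : Fin 3 × Fin 3, |(U (EuclideanSpace.single ab.2 (1 : ℝ))) ab.1 - (c (Sum.inl ab) : ℝ) / SC| ≤ (w (Sum.inl ab) : ℝ) / SC)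
    (hξ : ∀ i : Fin 3, |ξ i - (c (Sum.inr i) : ℝ) / SC| ≤ (w (Sum.inr i) : ℝ) / SC) (h0 : 0 ≤ ξ 0) (h2 : 0 ≤ ξ 2) :
    (∀ (M : ℕ) (z : Fin M → E3) (c : Fin M), Function.Injective z →
        Set.range z = {x : E3 | dist x (z c) ≤ 133 / 10 ∧ ∃ a : Fin 3 → ℤ,
          x = z c + latPt U hexFrame a ∨ x = z c + latPt U hexFrame a + U (hcpShift + ξ)} →
        TightNearCap (9 / 5) (3 / 2) z c ∨ ExemptNear (9 / 5) ExRec z c ∨ BadNearCap (9 / 5) (3 / 2) z c) ∨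
      (μ : ℝ) / SC ≤ ∑ b ∈ (Fintype.piFinset fun _ : Fin 3 => Finset.Icc (-7 : ℤ) 7).filter (fun b => b ≠ 0), effPot w₄₅ ω₄ (3 / 400) ‖latPt U hexFrame b‖ +
        ∑ b ∈ (Fintype.piFinset fun _ : Fin 3 => Finset.Icc (-7 : ℤ) 7), effPot w₄₅ ω₄ (3 / 400) ‖latPt U hexFrame b + U (hcpShift + ξ)‖ := by
  simp only [entryLeafOKHVK, entryLeafOKHVT, Bool.or_eq_true] at h
  rcases h with ((((h | h) | h) | h) | h) | h
  · exact (false_of_shufOut h hξ h0 h2).elim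
  · exact tableLeafOKHV_sound (tabSem_of_allOKK qTableK1_allOKK) h U ξ hsa hU (hbox_symU hsa hbox) hξ
  · exact tableLeafOKHV_sound (tabSem_of_allOKK qTableK2_allOKK) h U ξ hsa hU (hbox_symU hsa hbox) hξ
  · exact tableLeafOKHV_sound (tabSem_of_allOKK qTableK3_allOKK) h U ξ hsa hU (hbox_symU hsa hbox) hξ
  · exact tableLeafOKHV_sound (tabSem_of_allOKK qTableK4_allOKK) h U ξ hsa hU (hbox_symU hsa hbox) hξ
  · exact entryLeafOKH3RDTK_sound h U ξ hsa hU hbox hξ h0 h2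

/-- ★★ **THE hcp HALF FROM ONE SEARCH BOOLEAN with verdict v8 `entryLeafOKHVK μ`.** [folklore] -/
theorem hcpHalf_of_entrySearchHVK {m : ℝ} {μ : ℤ} (hμ : 2 * (m + (-(7175 / 10000) + 3 / 400)) * SC ≤ μ)
    {sel : ℕ → ((Fin 3 × Fin 3) ⊕ Fin 3 → ℤ) → ((Fin 3 × Fin 3) ⊕ Fin 3 → ℤ) → (Fin 3 × Fin 3) ⊕ Fin 3} {fuel d : ℕ}
    (h : searchOK (entryLeafOKHVK μ) sel fuel d rootCH rootWH = true) :
    ∀ (U : E3 →L[ℝ] E3) (ξ : E3), (∀ v w : E3, inner ℝ (U v) w = inner ℝ v (U w)) → (∀ w : E3, 0 ≤ inner ℝ w (U w)) →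
      ‖U - 1‖ ≤ 1 / 4 → ‖ξ‖ ≤ 1 / 4 → HcpDich m U ξ :=
  hcpHalf_of_entrySearchShuf hμ (entryLeafOKHVK μ) (fun _ _ hv U ξ hsa hU hbox hξ h0 h2 => entryLeafOKHVK_sound hv U ξ hsa hU hbox hξ h0 h2) h

/-- ★★★ **`(H) HomFloor m` FROM TWO SEARCH BOOLEANS: fcc param-form leaf `entryLeafOK6RBKP μ` (hand-1), hcp vector-form verdict v8 `entryLeafOKHVK μ`.**
[folklore] -/
theorem homFloor_of_entrySearches6RBKP_HVK {m : ℝ} {μ : ℤ} (hμ : 2 * (m + (-(7175 / 10000) + 3 / 400)) * SC ≤ μ)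
    {selF : ℕ → (Fin 3 × Fin 3 → ℤ) → (Fin 3 × Fin 3 → ℤ) → Fin 3 × Fin 3} {fuelF dF : ℕ}
    (hF : searchOK (entryLeafOK6RBKP μ) selF fuelF dF rootC rootW = true)
    {selH : ℕ → ((Fin 3 × Fin 3) ⊕ Fin 3 → ℤ) → ((Fin 3 × Fin 3) ⊕ Fin 3 → ℤ) → (Fin 3 × Fin 3) ⊕ Fin 3} {fuelH dH : ℕ}
    (hH : searchOK (entryLeafOKHVK μ) selH fuelH dH rootCH rootWH = true) : HomFloor m :=
  homFloor_of_prunedBoxSums_selfAdjoint (fccHalf_of_entrySearch6RBKP hμ hF) (hcpHalf_of_entrySearchHVK hμ hH)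

/-- ★★★ **`(H) HomFloor (1/625)`, TARGET CERTIFICATE v8**: `searchOK (entryLeafOK6RBKP muRec) … rootC rootW = true` and
`searchOK (entryLeafOKHVK muRec) … rootCH rootWH = true` give `HomFloor (1/625)`. [folklore] -/
theorem homFloor_625_of_entrySearches6RBKP_HVK
    {selF : ℕ → (Fin 3 × Fin 3 → ℤ) → (Fin 3 × Fin 3 → ℤ) → Fin 3 × Fin 3} {fuelF dF : ℕ}
    (hF : searchOK (entryLeafOK6RBKP muRec) selF fuelF dF rootC rootW = true)
    {selH : ℕ → ((Fin 3 × Fin 3) ⊕ Fin 3 → ℤ) → ((Fin 3 × Fin 3) ⊕ Fin 3 → ℤ) → (Fin 3 × Fin 3) ⊕ Fin 3} {fuelH dH : ℕ}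
    (hH : searchOK (entryLeafOKHVK muRec) selH fuelH dH rootCH rootWH = true) : HomFloor (1 / 625) :=
  homFloor_of_entrySearches6RBKP_HVK muRec_ok hF hH

end Summit.AtomisticToContinuum.Crystallization.Theorems.FrustratedLawDichotomyStrainedPatchHomLeafTableCheckHcpV

end
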